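import Summits.CriticalPhenomena.SAWScalingLimit.Theorems.SAWDevelopingMapHexTransferPortDictionarySegments
import Literature.Probability.RandomPlanarGeometry.SAWLists
import Mathlib.Topology.Algebra.InfiniteSum.ENNReal
import Mathlib.Data.ENNReal.BigOperators
import HarnessLib

/-!
# Port dictionary, part 4: summing compass lists face by face

Support file for item stmt-CriticalPhenomena-6966 (`SAWCompassLattice.PortDictionary`), stub
`stub_portDictionary` of line `Sketch` of crux stmt-CriticalPhenomena-14221 (`HexTransfer`);
continues parts 1–3.

* `passages ms f` (the ordered terminal pairs of the arcs of the port sequence `ms` drawn in the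
  face `f`), `facesOf ms`, and `Psi C U ms = ∏_{f ∈ facesOf ms} W (passages ms f) (U f)`;
* `Psi_cons_cons`: `Psi` obeys the same first-port recursion as the compass lists (part 3);
* `tsum_compassLists` (induction on the port sequence, over all `U`): for an admissible port
  sequence (no repeated port, ending at `b`, consecutive ports on a common face of `Δ`) the total
  `wtL`-weight of the compass lists is `Psi`; otherwise (`compassLists_eq_empty`) there is none.
-/

namespace Summit.CriticalPhenomena.SAWScalingLimit.Cruxes.HexTransfer.Sketch.PortDict

open Literature.Probability.RandomPlanarGeometry.SAW.YangBaxter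
open scoped ENNReal

/-! ## Passages and the face product `Psi` -/

/-- The ordered terminal pair of an arc, if it is drawn in the face `f`. -/
def termPair (f : Face) (p : MidEdge × MidEdge) : Option (Fin 4 × Fin 4) :=
  if arcFace p = some f then some (sideIdx f p.1, sideIdx f p.2) else none

/-- The passages of the port sequence `ms` through the face `f`, in order. -/
def passages (ms : List MidEdge) (f : Face) : List (Fin 4 × Fin 4) := (arcsOf ms).filterMap (termPair f)

/-- The faces carrying an arc of the port sequence `ms` (= `YBWalk.facesVisited` for a walk). -/
def facesOf (ms : List MidEdge) : Finset Face := ((arcsOf ms).filterMap arcFace).toFinset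

/-- **The face product.** `Psi C U ms = ∏_{f} W (passages ms f) (U f)`. -/
def Psi (C : Compass) (U : Face → List Node) (ms : List MidEdge) : ℝ :=
  ∏ f ∈ facesOf ms, W C.α C.β C.s C.z (passages ms f) (U f)

/-- `arcsOf` of a list with two heads. -/
theorem arcsOf_cons_cons (e₀ e₁ : MidEdge) (rest : List MidEdge) :
    arcsOf (e₀ :: e₁ :: rest) = (e₀, e₁) :: arcsOf (e₁ :: rest) := rfl

/-- `arcsOf` of a singleton. -/
theorem arcsOf_singleton (e : MidEdge) : arcsOf [e] = [] := rfl

/-- A face without arc has no passage. -/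
theorem passages_eq_nil {ms : List MidEdge} {f : Face} (h : f ∉ facesOf ms) : passages ms f = [] := by
  rw [passages, List.filterMap_eq_nil_iff]
  intro p hp
  rw [termPair, if_neg]
  intro hpf
  exact h (List.mem_toFinset.2 (List.mem_filterMap.2 ⟨p, hp, hpf⟩))

variable {e₀ e₁ : MidEdge} {rest : List MidEdge} {f : Face}

/-- Faces: the first arc adds its face. -/
theorem facesOf_cons_cons (hf : MidEdge.commonFace e₀ e₁ = some f) :
    facesOf (e₀ :: e₁ :: rest) = insert f (facesOf (e₁ :: rest)) := by
  rw [facesOf, arcsOf_cons_cons, List.filterMap_cons_some (show arcFace (e₀, e₁) = some f from hf),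
    List.toFinset_cons, facesOf]

/-- Passages: the first arc adds its terminal pair to its face only. -/
theorem passages_cons_cons (hf : MidEdge.commonFace e₀ e₁ = some f) (g : Face) :
    passages (e₀ :: e₁ :: rest) g =
      if g = f then (sideIdx f e₀, sideIdx f e₁) :: passages (e₁ :: rest) g else passages (e₁ :: rest) g := by
  rw [passages, arcsOf_cons_cons, List.filterMap_cons, passages]
  have : arcFace (e₀, e₁) = some f := hf
  by_cases hg : g = f
  · subst hg; simp [termPair, this]
  · rw [if_neg hg, termPair, if_neg]
    rw [this]; simpa using Ne.symm hg

/-- `Psi` of a single port is `1`. -/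
theorem Psi_singleton (C : Compass) (U : Face → List Node) (e : MidEdge) : Psi C U [e] = 1 := by
  simp [Psi, facesOf]

/-- **The first-port recursion of `Psi`.** -/
theorem Psi_cons_cons (C : Compass) (U : Face → List Node) (hf : MidEdge.commonFace e₀ e₁ = some f) :
    Psi C U (e₀ :: e₁ :: rest) =
      (((routes (sideIdx f e₀) (sideIdx f e₁)).filter (avoidB (U f))).map fun r =>
        C.z ^ 2 * routeW C.α C.β C.s r * Psi C (upd U f r) (e₁ :: rest)).sum := by
  classical
  set F' := facesOf (e₁ :: rest) with hF'
  set Prest := ∏ g ∈ F'.erase f, W C.α C.β C.s C.z (passages (e₁ :: rest) g) (U g) with hPrest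
  -- split the face `f` off the product, before and after
  have h1 : Psi C U (e₀ :: e₁ :: rest) =
      W C.α C.β C.s C.z ((sideIdx f e₀, sideIdx f e₁) :: passages (e₁ :: rest) f) (U f) * Prest := by
    rw [Psi, facesOf_cons_cons hf, ← Finset.mul_prod_erase _ _ (Finset.mem_insert_self f F'),
      Finset.erase_insert_eq_erase, passages_cons_cons hf, if_pos rfl]
    congr 1
    refine Finset.prod_congr rfl fun g hg => ?_
    rw [passages_cons_cons hf, if_neg (Finset.ne_of_mem_erase hg)]
  have h2 : ∀ r : List Node, Psi C (upd U f r) (e₁ :: rest) =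
      W C.α C.β C.s C.z (passages (e₁ :: rest) f) (U f ++ r) * Prest := by
    intro r
    have hcongr : ∀ g ∈ F'.erase f, W C.α C.β C.s C.z (passages (e₁ :: rest) g) (upd U f r g) =
        W C.α C.β C.s C.z (passages (e₁ :: rest) g) (U g) := fun g hg => by
      rw [upd_apply, if_neg (Finset.ne_of_mem_erase hg)]
    by_cases hfF : f ∈ F'
    · rw [Psi, ← hF', ← Finset.mul_prod_erase _ _ hfF, upd_apply, if_pos rfl, Finset.prod_congr rfl hcongr]
    · rw [Psi, ← hF', passages_eq_nil hfF, W_nil, one_mul, hPrest, Finset.erase_eq_of_notMem hfF]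
      refine Finset.prod_congr rfl fun g hg => ?_
      rw [upd_apply, if_neg]
      rintro rfl; exact hfF hg
  rw [h1, W_cons, ← List.sum_map_mul_right]
  refine congrArg List.sum (List.map_congr_left fun r _ => ?_)
  rw [h2]; ring

/-- `Psi` is non-negative. -/
theorem Psi_nonneg (C : Compass) (U : Face → List Node) (ms : List MidEdge) : 0 ≤ Psi C U ms :=
  Finset.prod_nonneg fun _ _ => W_nonneg C.hα C.hβ C.hs _ _

/-! ## Summing the compass lists -/

namespace Compass

variable {C : Compass} {Δ : Set Face} {U : Face → List Node} {a b : MidEdge} {ms : List MidEdge}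

/-- The port sequence starts with the starting port. -/
theorem head?_eq_of_mem_compassLists {l : List V} (h : l ∈ C.compassLists Δ U a b ms) : ms.head? = some a := by
  obtain ⟨h1, -, -, -, -, h6, -⟩ := h
  obtain ⟨t, rfl⟩ := List.head?_eq_some_iff.1 h1
  rw [← h6]
  simp

/-- A compass list with a single port is the trivial one. -/
theorem mem_compassLists_singleton {l : List V} {e : MidEdge} :
    l ∈ C.compassLists Δ U e b [e] ↔ l = [Sum.inl e] ∧ e = b := by
  constructor
  · rintro ⟨h1, h2, h3, -, -, h6, -⟩
    obtain ⟨t, rfl⟩ := List.head?_eq_some_iff.1 h1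
    have ht : t.filterMap Sum.getLeft? = [] := by simpa using h6
    cases t with
    | nil =>
      simp only [List.getLast?_singleton, Option.some.injEq, Sum.inl.injEq] at h2
      exact ⟨rfl, h2⟩
    | cons x t =>
      exfalso
      rw [List.filterMap_eq_nil_iff] at ht
      obtain ⟨w, hw⟩ := List.getLast?_eq_some_iff.1 h2
      have hmem : Sum.inl b ∈ x :: t := by
        have : Sum.inl b ∈ Sum.inl e :: x :: t := by rw [hw]; simp
        rcases List.mem_cons.1 this with h | h
        · -- then `inl b = inl e` is the head; but the last element of a list of length ≥ 2 with
          -- nodup... simpler: the last element lies in `x :: t` anyway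
          have hlast : (Sum.inl e :: x :: t).getLast (by simp) = Sum.inl b := by
            rw [List.getLast_eq_iff_getLast?_eq_some]; exact h2
          rw [List.getLast_cons (by simp)] at hlast
          rw [← hlast]; exact List.getLast_mem _
        · exact h
      have := ht _ hmem
      simp at this
  · rintro ⟨rfl, rfl⟩
    refine ⟨rfl, rfl, List.IsChain.singleton _, List.nodup_singleton _, ?_, rfl, ?_⟩ <;> simp


/-- `ofReal` of a list sum of non-negative reals. -/
theorem ofReal_list_sum {ι : Type*} (l : List ι) (g : ι → ℝ) (hg : ∀ x ∈ l, 0 ≤ g x) :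
    ENNReal.ofReal ((l.map g).sum) = (l.map fun x => ENNReal.ofReal (g x)).sum := by
  induction l with
  | nil => simp
  | cons x l ih =>
    simp only [List.map_cons, List.sum_cons]
    rw [ENNReal.ofReal_add (hg x (by simp)) (List.sum_nonneg (by simpa using fun y hy => hg y (by simp [hy]))),
      ih fun y hy => hg y (by simp [hy])]

variable (C Δ b) in
/-- **The first-port recursion of the compass sum** (bijection of part 3 + `tsum` over a sigma type). -/
theorem tsum_compassLists_cons_cons (U : Face → List Node) {e₀ e₁ : MidEdge} {rest : List MidEdge} {f : Face}
    (hf : MidEdge.commonFace e₀ e₁ = some f) (hfΔ : f ∈ Δ) (he₀ : e₀ ∉ e₁ :: rest) :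
    ∑' l : C.compassLists Δ U e₀ b (e₀ :: e₁ :: rest), ENNReal.ofReal (C.wtL l) =
      (((routes (sideIdx f e₀) (sideIdx f e₁)).filter (avoidB (U f))).map fun r =>
        ENNReal.ofReal (C.z ^ 2 * routeW C.α C.β C.s r) *
          ∑' l₂ : C.compassLists Δ (upd U f r) e₁ b (e₁ :: rest), ENNReal.ofReal (C.wtL l₂)).sum := by
  classical
  set L := (routes (sideIdx f e₀) (sideIdx f e₁)).filter (avoidB (U f)) with hL
  have hLnd : L.Nodup := (nodup_routes _ _).filter _
  -- the gluing map from the sigma type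
  let T : Type := Σ r : {r // r ∈ L.toFinset}, C.compassLists Δ (upd U f r.1) e₁ b (e₁ :: rest)
  let glue : T → C.compassLists Δ U e₀ b (e₀ :: e₁ :: rest) := fun x =>
    ⟨Sum.inl e₀ :: (x.1.1.map (ι f) ++ x.2.1), by
      have hr := List.mem_filter.1 (List.mem_toFinset.1 x.1.2)
      exact cons_mem_compassLists hf hfΔ he₀ hr.1 (avoidB_iff.1 hr.2) x.2.2⟩
  have hbij : Function.Bijective glue := by
    constructor
    · rintro ⟨⟨r, hr⟩, l₂, hl₂⟩ ⟨⟨r', hr'⟩, l₂', hl₂'⟩ h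
      have h' : r.map (ι f) ++ l₂ = r'.map (ι f) ++ l₂' := by
        have := congrArg Subtype.val h
        simpa [glue] using this
      obtain ⟨t, rfl⟩ := List.head?_eq_some_iff.1 hl₂.1
      obtain ⟨t', rfl⟩ := List.head?_eq_some_iff.1 hl₂'.1
      obtain ⟨h1, h2⟩ := Literature.Probability.RandomPlanarGeometry.SAW.append_inj_of_head
        (p := fun v : V => v.isLeft) (by simp [ι]) (by simp) (by simp [ι]) (by simp) h'
      obtain rfl : r = r' := (List.map_injective_iff.2 (ι_injective f)) h1
      obtain rfl : t = t' := by simpa using h2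
      rfl
    · rintro ⟨l, hl⟩
      obtain ⟨f', r, l₂, hf', hf'Δ, -, hr, hrU, hl₂, rfl⟩ := mem_compassLists_cons_cons hl
      obtain rfl : f = f' := Option.some_injective _ (hf.symm.trans hf')
      exact ⟨⟨⟨r, List.mem_toFinset.2 (List.mem_filter.2 ⟨hr, avoidB_iff.2 hrU⟩)⟩, ⟨l₂, hl₂⟩⟩, rfl⟩
  rw [← (Equiv.ofBijective glue hbij).tsum_eq]
  simp only [Equiv.ofBijective_apply]
  rw [ENNReal.tsum_sigma']
  have hterm : ∀ (r : {r // r ∈ L.toFinset}) (l₂ : C.compassLists Δ (upd U f r.1) e₁ b (e₁ :: rest)),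
      ENNReal.ofReal (C.wtL (glue ⟨r, l₂⟩).1) =
        ENNReal.ofReal (C.z ^ 2 * routeW C.α C.β C.s r.1) * ENNReal.ofReal (C.wtL l₂.1) := by
    intro r l₂
    have hr := (mem_routes_iff.1 (List.mem_filter.1 (List.mem_toFinset.1 r.2)).1).1
    have hrne : r.1 ≠ [] := by intro h0; rw [h0] at hr; simp at hr
    rw [← ENNReal.ofReal_mul (mul_nonneg (sq_nonneg _) (routeW_nonneg C.hα C.hβ C.hs _))]
    exact congrArg _ (C.wtL_glue e₀ f hrne l₂.2.1)
  simp_rw [hterm, ENNReal.tsum_mul_left]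
  rw [Finset.tsum_subtype L.toFinset fun r => ENNReal.ofReal (C.z ^ 2 * routeW C.α C.β C.s r) *
      ∑' l₂ : C.compassLists Δ (upd U f r) e₁ b (e₁ :: rest), ENNReal.ofReal (C.wtL l₂.1),
    List.sum_toFinset _ hLnd]

variable (C Δ b) in
/-- **No compass list for an inadmissible port sequence** (a repeated port, a wrong final port,
or two consecutive ports not on a common face of `Δ`). -/
theorem compassLists_eq_empty : ∀ (ms : List MidEdge) (e₀ : MidEdge) (U : Face → List Node),
    ¬((e₀ :: ms).Nodup ∧ (e₀ :: ms).getLast? = some b ∧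
        ∀ p ∈ arcsOf (e₀ :: ms), ∃ f ∈ Δ, arcFace p = some f) →
      C.compassLists Δ U e₀ b (e₀ :: ms) = ∅
  | [], e₀, U, h => by
    ext l
    simp only [Set.mem_empty_iff_false, iff_false]
    intro hl
    obtain ⟨rfl, rfl⟩ := mem_compassLists_singleton.1 hl
    exact h ⟨List.nodup_singleton _, rfl, by simp⟩
  | e₁ :: rest, e₀, U, h => by
    ext l
    simp only [Set.mem_empty_iff_false, iff_false]
    intro hl
    obtain ⟨f, r, l₂, hf, hfΔ, he₀, -, -, hl₂, rfl⟩ := mem_compassLists_cons_cons hl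
    by_cases h' : (e₁ :: rest).Nodup ∧ (e₁ :: rest).getLast? = some b ∧
        ∀ p ∈ arcsOf (e₁ :: rest), ∃ f ∈ Δ, arcFace p = some f
    · refine h ⟨List.nodup_cons.2 ⟨he₀, h'.1⟩, ?_, ?_⟩
      · rw [List.getLast?_cons_cons]; exact h'.2.1
      · intro p hp
        rw [arcsOf_cons_cons, List.mem_cons] at hp
        rcases hp with rfl | hp
        · exact ⟨f, hfΔ, hf⟩
        · exact h'.2.2 p hp
    · rw [compassLists_eq_empty rest e₁ (upd U f r) h'] at hl₂
      exact hl₂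

variable (C Δ b) in
/-- **The compass sum equals the face product** for an admissible port sequence. -/
theorem tsum_compassLists : ∀ (ms : List MidEdge) (e₀ : MidEdge) (U : Face → List Node),
    (e₀ :: ms).Nodup → (e₀ :: ms).getLast? = some b →
      (∀ p ∈ arcsOf (e₀ :: ms), ∃ f ∈ Δ, arcFace p = some f) →
      ∑' l : C.compassLists Δ U e₀ b (e₀ :: ms), ENNReal.ofReal (C.wtL l) = ENNReal.ofReal (Psi C U (e₀ :: ms))
  | [], e₀, U, _, hlast, _ => by
    obtain rfl : b = e₀ := by simpa [eq_comm] using hlast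
    rw [Psi_singleton, ENNReal.ofReal_one]
    have hset : C.compassLists Δ U b b [b] = {[Sum.inl b]} := by
      ext l; rw [Set.mem_singleton_iff, mem_compassLists_singleton]; simp
    rw [hset, tsum_singleton (f := fun l : List V => ENNReal.ofReal (C.wtL l))]
    simp
  | e₁ :: rest, e₀, U, hnd, hlast, harcs => by
    obtain ⟨f, hfΔ, hf'⟩ := harcs (e₀, e₁) (by rw [arcsOf_cons_cons]; exact List.mem_cons_self)
    have hf : MidEdge.commonFace e₀ e₁ = some f := hf'
    have he₀ : e₀ ∉ e₁ :: rest := (List.nodup_cons.1 hnd).1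
    have IH : ∀ r : List Node,
        ∑' l₂ : C.compassLists Δ (upd U f r) e₁ b (e₁ :: rest), ENNReal.ofReal (C.wtL l₂) =
          ENNReal.ofReal (Psi C (upd U f r) (e₁ :: rest)) := fun r =>
      tsum_compassLists rest e₁ (upd U f r) (List.nodup_cons.1 hnd).2
        (by rw [List.getLast?_cons_cons] at hlast; exact hlast)
        fun p hp => harcs p (by rw [arcsOf_cons_cons]; exact List.mem_cons_of_mem _ hp)
    rw [C.tsum_compassLists_cons_cons Δ b U hf hfΔ he₀, Psi_cons_cons C U hf,
      ofReal_list_sum _ _ fun r _ => mul_nonneg (mul_nonneg (sq_nonneg _)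
        (routeW_nonneg C.hα C.hβ C.hs _)) (Psi_nonneg C _ _)]
    refine congrArg List.sum (List.map_congr_left fun r _ => ?_)
    rw [IH r, ENNReal.ofReal_mul (mul_nonneg (sq_nonneg _) (routeW_nonneg C.hα C.hβ C.hs _))]

end Compass

end Summit.CriticalPhenomena.SAWScalingLimit.Cruxes.HexTransfer.Sketch.PortDict
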